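import Literature.NumberTheory.LFunctions.MertensSecondLogPower
import HarnessLib

/-!
# Decay of `ζ(s, y)` away from the real axis from the prime number theorem (Hildebrand–Tenenbaum Lemma 8(ii))

Topic `Literature/NumberTheory/Sieve`; a PROVED tool file. Hildebrand–Tenenbaum bound
`|ζ(α + iτ, y)/ζ(α, y)| ≤ e^{-W(τ)}`, `W(τ) = Σ_{p ≤ y} p^{-α}(1 - cos(τ log p))`, and obtain the lower bound
`W(τ) ≫ ū τ²/((1 - α)² + τ²)` for `1/log y ≤ |τ| ≤ Y(ε)` [HildebrandTenenbaum1986, Lemma 8 (3.16)] from the prime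
number theorem for `Σ_{n ≤ y} Λ(n) n^{-s}` with Vinogradov's zero-free region (their Lemma 6, needed only to
reach the height `Y(ε) = exp((log y)^{3/2-ε})`). Here the same computation is carried out with the classical
prime number theorem `ϑ(t) = t + O(t/log² t)` (PROVED in the tree, `exists_abs_theta_sub_le_div_log_pow`), which
gives the lower bound with an error linear in `|τ|` — enough for heights `|τ|` up to a small multiple of
`log y/((1 - α) log y)`, the range in which it is used by the Gaussian-smoothed saddle-point argument:

* `exists_sum_log_mul_decay_ge` — for `y ≥ 2`, `0 ≤ σ < 1`, `β = 1 - σ` and real `τ`,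
  `Σ_{p ≤ y} log p · p^{-σ}(1 - cos(τ log p)) ≥ y^β τ²/(2β(β² + τ²)) - C(1 + |τ|) y^β - 4/β`
  (partial summation from `ϑ`; the main term is `∫_2^y t^{-σ}(1 - cos(τ log t)) dt`, computed exactly);
* `exists_decaySum_ge_pnt` — the same divided by `log y`:
  `Σ_{p ≤ y} p^{-σ}(1 - cos(τ log p)) ≥ (y^β τ²/(2β(β² + τ²)) - C(1 + |τ|) y^β - 4/β)/log y`.

In the application `σ = α(x, y)`, `y^β/(β log y) ≍ u`, and the right side is `≫ u τ²/(β² + τ²)` as long as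
`(1 + |τ|)(1 - α) log y` is small against `τ² log y/(β² + τ²)` [HildebrandTenenbaum1986, (3.18) and the display
following it].

## References

* [HildebrandTenenbaum1986] A. Hildebrand, G. Tenenbaum, Trans. AMS 296 (1986) 265–290, Lemma 6, its Corollary, and
  Lemma 8 (ii) with its proof (held: `paper:doi-10-1090-s0002-9947-1986-0837811-1`, pp. 274–276).
* H. L. Montgomery, R. C. Vaughan, *Multiplicative Number Theory I*, CUP 2007, Thm 6.9 (the prime number theorem
  with error term, tree `ChebyshevThetaDeLaValleePoussin_holds`).
-/

noncomputable section

open Real Set MeasureTheory Finset Filter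
open scoped Chebyshev

namespace Literature.NumberTheory.Sieve

namespace DecayPNT

open Literature.NumberTheory.LFunctions.Mertens

variable {σ τ t : ℝ}

/-! ### The test function `f(t) = t^{-σ}(1 - cos(τ log t))` and its primitives -/

/-- `f(t) = t^{-σ}(1 - cos(τ log t))`. [folklore] -/
def f (σ τ t : ℝ) : ℝ := t ^ (-σ) * (1 - Real.cos (τ * Real.log t))

/-- `f'(t) = -σ t^{-σ-1}(1 - cos(τ log t)) + τ t^{-σ-1} sin(τ log t)`. [folklore] -/
def f' (σ τ t : ℝ) : ℝ :=
  -σ * t ^ (-σ - 1) * (1 - Real.cos (τ * Real.log t)) + t ^ (-σ - 1) * (τ * Real.sin (τ * Real.log t))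

/-- The primitive of `f`: `G(t) = t^β/β - t^β (β cos(τ log t) + τ sin(τ log t))/(β² + τ²)`, `β = 1 - σ`.
[cite: HildebrandTenenbaum1986, Corollary to Lemma 6] -/
def G (σ τ t : ℝ) : ℝ :=
  t ^ (1 - σ) / (1 - σ) -
    t ^ (1 - σ) * ((1 - σ) * Real.cos (τ * Real.log t) + τ * Real.sin (τ * Real.log t)) / ((1 - σ) ^ 2 + τ ^ 2)

/-- `f ≥ 0`. [folklore] -/
theorem f_nonneg (ht : 0 ≤ t) (σ τ : ℝ) : 0 ≤ f σ τ t :=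
  mul_nonneg (Real.rpow_nonneg ht _) (by linarith [Real.cos_le_one (τ * Real.log t)])

/-- `f(t) ≤ 2 t^{-σ}`. [folklore] -/
theorem f_le (ht : 0 ≤ t) (σ τ : ℝ) : f σ τ t ≤ 2 * t ^ (-σ) := by
  have h := Real.neg_one_le_cos (τ * Real.log t)
  have h0 := Real.rpow_nonneg ht (-σ)
  unfold f; nlinarith

/-- `HasDerivAt f f'` at `t > 0`. [folklore] -/
theorem hasDerivAt_f (ht : 0 < t) (σ τ : ℝ) : HasDerivAt (f σ τ) (f' σ τ t) t := by
  have h1 : HasDerivAt (fun t : ℝ => t ^ (-σ)) (-σ * t ^ (-σ - 1)) t :=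
    Real.hasDerivAt_rpow_const (Or.inl ht.ne')
  have hlog : HasDerivAt (fun t : ℝ => τ * Real.log t) (τ * t⁻¹) t :=
    (Real.hasDerivAt_log ht.ne').const_mul τ
  have h2 : HasDerivAt (fun t : ℝ => 1 - Real.cos (τ * Real.log t))
      (Real.sin (τ * Real.log t) * (τ * t⁻¹)) t := by
    simpa using (hlog.cos).const_sub 1
  have h := h1.mul h2
  have hpow : t ^ (-σ) = t ^ (-σ - 1) * t := by
    rw [show -σ = (-σ - 1) + 1 by ring, Real.rpow_add ht, Real.rpow_one]; ring_nf
  refine h.congr_deriv ?_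
  unfold f'
  rw [hpow]
  field_simp

/-- `HasDerivAt G f` at `t > 0` (`σ < 1`). [folklore] -/
theorem hasDerivAt_G (ht : 0 < t) (hσ : σ < 1) (τ : ℝ) : HasDerivAt (G σ τ) (f σ τ t) t := by
  have hβ : 0 < 1 - σ := by linarith
  have hD : (1 - σ) ^ 2 + τ ^ 2 ≠ 0 := by positivity
  have h1 : HasDerivAt (fun t : ℝ => t ^ (1 - σ)) ((1 - σ) * t ^ (1 - σ - 1)) t :=
    Real.hasDerivAt_rpow_const (Or.inl ht.ne')
  have hlog : HasDerivAt (fun t : ℝ => τ * Real.log t) (τ * t⁻¹) t :=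
    (Real.hasDerivAt_log ht.ne').const_mul τ
  have hc : HasDerivAt (fun t : ℝ => (1 - σ) * Real.cos (τ * Real.log t) + τ * Real.sin (τ * Real.log t))
      ((1 - σ) * (-Real.sin (τ * Real.log t) * (τ * t⁻¹)) + τ * (Real.cos (τ * Real.log t) * (τ * t⁻¹))) t :=
    (hlog.cos.const_mul (1 - σ)).add (hlog.sin.const_mul τ)
  have h := (h1.div_const (1 - σ)).sub ((h1.mul hc).div_const ((1 - σ) ^ 2 + τ ^ 2))
  have hpow1 : t ^ (1 - σ - 1) = t ^ (-σ) := by congr 1; ring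
  have hpow : t ^ (1 - σ) = t ^ (-σ) * t := by
    rw [show (1 - σ) = -σ + 1 by ring, Real.rpow_add ht, Real.rpow_one]
  refine h.congr_deriv ?_
  rw [hpow1, hpow, f]
  field_simp
  ring

/-- **The main term**: `G(y) - G(2) ≥ y^β τ²/(2β(β² + τ²)) - 4/β` (`y ≥ 2`, `0 ≤ σ < 1`, `β = 1 - σ`):
`β cos θ + τ sin θ ≤ √(β² + τ²)` and `1/β - 1/√(β² + τ²) ≥ τ²/(2β(β² + τ²))`.
[cite: HildebrandTenenbaum1986, proof of Lemma 8 (ii)] -/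
theorem G_sub_G_ge {y : ℝ} (hy : 2 ≤ y) (hσ0 : 0 ≤ σ) (hσ : σ < 1) (τ : ℝ) :
    y ^ (1 - σ) * τ ^ 2 / (2 * (1 - σ) * ((1 - σ) ^ 2 + τ ^ 2)) - 4 / (1 - σ) ≤ G σ τ y - G σ τ 2 := by
  set β : ℝ := 1 - σ with hβdef
  have hβ : 0 < β := by rw [hβdef]; linarith
  have hβ1 : β ≤ 1 := by rw [hβdef]; linarith
  set R : ℝ := Real.sqrt (β ^ 2 + τ ^ 2) with hR
  have hR2 : R ^ 2 = β ^ 2 + τ ^ 2 := Real.sq_sqrt (by positivity)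
  have hRβ : β ≤ R := by
    have h := Real.abs_le_sqrt (show β ^ 2 ≤ β ^ 2 + τ ^ 2 by nlinarith)
    rwa [abs_of_pos hβ, ← hR] at h
  have hR0 : 0 < R := lt_of_lt_of_le hβ hRβ
  -- Cauchy–Schwarz for the trigonometric combination
  have hCS : ∀ φ : ℝ, |β * Real.cos φ + τ * Real.sin φ| ≤ R := by
    intro φ
    have hcs := Real.cos_sq_add_sin_sq φ
    rw [hR]
    refine Real.abs_le_sqrt ?_
    nlinarith [sq_nonneg (β * Real.sin φ - τ * Real.cos φ)]
  have hy0 : 0 < y := by linarith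
  have hyβ : 0 < y ^ β := Real.rpow_pos_of_pos hy0 β
  have h2β : (2 : ℝ) ^ β ≤ 2 := by
    calc (2 : ℝ) ^ β ≤ (2 : ℝ) ^ (1 : ℝ) := Real.rpow_le_rpow_of_exponent_le (by norm_num) hβ1
      _ = 2 := Real.rpow_one 2
  have h2β0 : 0 < (2 : ℝ) ^ β := Real.rpow_pos_of_pos (by norm_num) β
  have hD : 0 < β ^ 2 + τ ^ 2 := by positivity
  -- `G(y) ≥ y^β (1/β - 1/R)`
  have hGy : y ^ β * (1 / β - 1 / R) ≤ G σ τ y := by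
    have h1 := hCS (τ * Real.log y)
    have h1' := (abs_le.1 h1).2
    have : y ^ β * (β * Real.cos (τ * Real.log y) + τ * Real.sin (τ * Real.log y)) / (β ^ 2 + τ ^ 2) ≤
        y ^ β * R / R ^ 2 := by
      rw [hR2]
      exact div_le_div_of_nonneg_right (mul_le_mul_of_nonneg_left h1' hyβ.le) hD.le
    have hRR : y ^ β * R / R ^ 2 = y ^ β / R := by field_simp
    unfold G
    rw [← hβdef]
    rw [hRR] at this
    have : y ^ β * (1 / β - 1 / R) = y ^ β / β - y ^ β / R := by ring
    linarith
  -- `G(2) ≤ 4/β`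
  have hG2 : G σ τ 2 ≤ 4 / β := by
    have h1 := hCS (τ * Real.log 2)
    have h1' := (abs_le.1 h1).1
    have : -((2 : ℝ) ^ β * R / R ^ 2) ≤
        (2 : ℝ) ^ β * (β * Real.cos (τ * Real.log 2) + τ * Real.sin (τ * Real.log 2)) / (β ^ 2 + τ ^ 2) := by
      rw [hR2, ← neg_div, ← mul_neg]
      exact div_le_div_of_nonneg_right (mul_le_mul_of_nonneg_left h1' h2β0.le) hD.le
    have hRR : (2 : ℝ) ^ β * R / R ^ 2 = (2 : ℝ) ^ β / R := by field_simp
    rw [hRR] at this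
    have hb1 : (2 : ℝ) ^ β / β ≤ 2 / β := div_le_div_of_nonneg_right h2β hβ.le
    have hb2 : (2 : ℝ) ^ β / R ≤ 2 / β :=
      (div_le_div_of_nonneg_left h2β0.le hβ hRβ).trans (div_le_div_of_nonneg_right h2β hβ.le)
    unfold G
    rw [← hβdef]
    have : (4 : ℝ) / β = 2 / β + 2 / β := by ring
    linarith
  -- `1/β - 1/R ≥ τ²/(2β(β²+τ²))`
  have hkey : τ ^ 2 / (2 * β * (β ^ 2 + τ ^ 2)) ≤ 1 / β - 1 / R := by
    have hsub : (R - β) * (R + β) = τ ^ 2 := by nlinarith [hR2]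
    rw [div_sub_div _ _ hβ.ne' hR0.ne', one_mul, mul_one, div_le_div_iff₀ (by positivity) (by positivity)]
    -- `τ² (β R) ≤ (R - β) (2β(β²+τ²))`, i.e. `(R-β)(R+β) β R ≤ (R-β) 2β R²`... via `R + β ≤ 2R`
    have hRb : 0 ≤ R - β := by linarith
    calc τ ^ 2 * (β * R) = (R - β) * ((R + β) * (β * R)) := by rw [← hsub]; ring
      _ ≤ (R - β) * (2 * β * (β ^ 2 + τ ^ 2)) := by
          apply mul_le_mul_of_nonneg_left _ hRb
          rw [← hR2]; nlinarith [mul_pos hβ hR0]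
  have : y ^ β * (τ ^ 2 / (2 * β * (β ^ 2 + τ ^ 2))) ≤ y ^ β * (1 / β - 1 / R) :=
    mul_le_mul_of_nonneg_left hkey hyβ.le
  rw [show y ^ β * τ ^ 2 / (2 * β * (β ^ 2 + τ ^ 2)) = y ^ β * (τ ^ 2 / (2 * β * (β ^ 2 + τ ^ 2))) by ring]
  linarith

/-- `f'` is continuous at `t > 0`. [folklore] -/
theorem continuousAt_f' (ht : 0 < t) (σ τ : ℝ) : ContinuousAt (f' σ τ) t := by
  have h1 : ContinuousAt (fun t : ℝ => t ^ (-σ - 1)) t := Real.continuousAt_rpow_const _ _ (Or.inl ht.ne')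
  have h2 : ContinuousAt (fun t : ℝ => τ * Real.log t) t := continuousAt_const.mul (Real.continuousAt_log ht.ne')
  have hcos : ContinuousAt (fun t : ℝ => Real.cos (τ * Real.log t)) t :=
    ContinuousAt.comp (g := Real.cos) Real.continuous_cos.continuousAt h2
  have hsin : ContinuousAt (fun t : ℝ => Real.sin (τ * Real.log t)) t :=
    ContinuousAt.comp (g := Real.sin) Real.continuous_sin.continuousAt h2
  unfold f'
  exact ((continuousAt_const.mul h1).mul (continuousAt_const.sub hcos)).add (h1.mul (continuousAt_const.mul hsin))

/-- `|f'(t)| ≤ (2σ + |τ|) t^{-σ-1}` for `t > 0`, `σ ≥ 0`. [folklore] -/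
theorem abs_f'_le (ht : 0 < t) (hσ : 0 ≤ σ) (τ : ℝ) : |f' σ τ t| ≤ (2 * σ + |τ|) * t ^ (-σ - 1) := by
  have hQ : 0 < t ^ (-σ - 1) := Real.rpow_pos_of_pos ht _
  have hc1 := Real.cos_le_one (τ * Real.log t)
  have hc2 := Real.neg_one_le_cos (τ * Real.log t)
  have hs := Real.abs_sin_le_one (τ * Real.log t)
  have h1 : |-σ * t ^ (-σ - 1) * (1 - Real.cos (τ * Real.log t))| ≤ 2 * σ * t ^ (-σ - 1) := by
    rw [abs_mul, abs_mul, abs_neg, abs_of_nonneg hσ, abs_of_pos hQ, abs_of_nonneg (by linarith)]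
    have := mul_le_mul_of_nonneg_left (show 1 - Real.cos (τ * Real.log t) ≤ 2 by linarith) (mul_nonneg hσ hQ.le)
    linarith
  have h2 : |t ^ (-σ - 1) * (τ * Real.sin (τ * Real.log t))| ≤ |τ| * t ^ (-σ - 1) := by
    rw [abs_mul, abs_of_pos hQ, abs_mul]
    calc t ^ (-σ - 1) * (|τ| * |Real.sin (τ * Real.log t)|) = t ^ (-σ - 1) * |τ| * |Real.sin (τ * Real.log t)| := by
          ring
      _ ≤ t ^ (-σ - 1) * |τ| * 1 := mul_le_mul_of_nonneg_left hs (by positivity)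
      _ = |τ| * t ^ (-σ - 1) := by ring
  unfold f'
  calc _ ≤ |-σ * t ^ (-σ - 1) * (1 - Real.cos (τ * Real.log t))| + |t ^ (-σ - 1) * (τ * Real.sin (τ * Real.log t))| :=
        abs_add_le _ _
    _ ≤ 2 * σ * t ^ (-σ - 1) + |τ| * t ^ (-σ - 1) := add_le_add h1 h2
    _ = (2 * σ + |τ|) * t ^ (-σ - 1) := by ring

/-! ### Partial summation from `ϑ` -/

set_option maxHeartbeats 400000 in
/-- **Hildebrand–Tenenbaum's Lemma 8(ii) from the classical prime number theorem.** There is `C ≥ 0` such that for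
all `y ≥ 2`, `0 ≤ σ < 1` (`β = 1 - σ`) and real `τ`,
`Σ_{p ≤ y} log p · p^{-σ}(1 - cos(τ log p)) ≥ y^β τ²/(2β(β² + τ²)) - C(1 + |τ|) y^β - 4/β`.
Proof: partial summation `Σ_{2 < p ≤ y} f(p) log p = f(y)ϑ(y) - f(2)ϑ(2) - ∫_2^y f'ϑ`, `ϑ(t) = t + O(t/log²t)`
(tree `exists_abs_theta_sub_le_div_log_pow`), `∫_2^y (f + tf') = [tf]_2^y`, `∫_2^y f = G(y) - G(2)` and `G_sub_G_ge`;
the error terms are `≤ (2σ + |τ|) C₂ y^β ∫_2^∞ dt/(t log²t) + 2C₂ y^β/log²2 + 4C₂/log²2`.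
[cite: HildebrandTenenbaum1986, Lemma 6, Corollary, and Lemma 8 (ii) (proof)] -/
theorem exists_sum_log_mul_decay_ge :
    ∃ C : ℝ, 0 ≤ C ∧ ∀ (y : ℕ), 2 ≤ y → ∀ (σ τ : ℝ), 0 ≤ σ → σ < 1 →
      (y : ℝ) ^ (1 - σ) * τ ^ 2 / (2 * (1 - σ) * ((1 - σ) ^ 2 + τ ^ 2)) -
          C * (1 + |τ|) * (y : ℝ) ^ (1 - σ) - 4 / (1 - σ) ≤
        ∑ p ∈ Nat.primesLE y, Real.log p * ((p : ℝ) ^ (-σ) * (1 - Real.cos (τ * Real.log p))) := by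
  obtain ⟨C₂, hC₂0, hC₂⟩ := exists_abs_theta_sub_le_div_log_pow 2
  refine ⟨17 * C₂, by positivity, fun y hy σ τ hσ0 hσ1 => ?_⟩
  set Y : ℝ := (y : ℝ) with hYdef
  have hY2 : (2 : ℝ) ≤ Y := by rw [hYdef]; exact_mod_cast hy
  have hY0 : 0 < Y := by linarith
  set β : ℝ := 1 - σ with hβdef
  have hβ0 : 0 < β := by rw [hβdef]; linarith
  have hYβ1 : 1 ≤ Y ^ β := Real.one_le_rpow (by linarith) hβ0.le
  have hlog2 : (2 : ℝ) / 3 < Real.log 2 := by have := Real.log_two_gt_d9; linarith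
  -- the coefficients and the summatory function `ϑ`
  set c : ℕ → ℝ := fun k => if k.Prime then Real.log k else 0 with hc
  have hS : ∀ t : ℝ, ∑ k ∈ Icc 0 ⌊t⌋₊, c k = θ t := fun t => by
    rw [Chebyshev.theta_eq_sum_Icc, Finset.sum_filter]
  -- Abel summation on `[2, Y]`
  have hf_diff : ∀ t ∈ Set.Icc 2 Y, DifferentiableAt ℝ (f σ τ) t := fun t ht =>
    (hasDerivAt_f (by linarith [ht.1]) σ τ).differentiableAt
  have hderiv : ∀ t : ℝ, 0 < t → deriv (f σ τ) t = f' σ τ t := fun t ht => (hasDerivAt_f ht σ τ).deriv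
  have hf'_cont : ContinuousOn (f' σ τ) (Set.Icc 2 Y) := fun t ht =>
    (continuousAt_f' (by linarith [ht.1]) σ τ).continuousWithinAt
  have hf_cont : ContinuousOn (f σ τ) (Set.Icc 2 Y) := fun t ht =>
    (hasDerivAt_f (by linarith [ht.1]) σ τ).continuousAt.continuousWithinAt
  have hf_int : IntegrableOn (deriv (f σ τ)) (Set.Icc 2 Y) :=
    hf'_cont.integrableOn_Icc.congr_fun (fun t ht => (hderiv t (by linarith [ht.1])).symm) measurableSet_Icc
  have habel := sum_mul_eq_sub_sub_integral_mul c (by norm_num : (0 : ℝ) ≤ 2) hY2 hf_diff hf_int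
  have hfl2 : ⌊(2 : ℝ)⌋₊ = 2 := by norm_num
  have hflY : ⌊Y⌋₊ = y := by rw [hYdef, Nat.floor_natCast]
  have hSY : ∑ k ∈ Icc 0 y, c k = θ Y := by have := hS Y; rwa [hflY] at this
  have hS2 : ∑ k ∈ Icc 0 2, c k = θ 2 := by have := hS 2; rwa [hfl2] at this
  rw [hfl2, hflY, hSY, hS2] at habel
  simp_rw [hS] at habel
  -- the left side of Abel is at most the full prime sum
  have hlhs : ∑ k ∈ Finset.Ioc 2 y, f σ τ k * c k ≤
      ∑ p ∈ Nat.primesLE y, Real.log p * ((p : ℝ) ^ (-σ) * (1 - Real.cos (τ * Real.log p))) := by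
    have h1 : ∑ k ∈ Finset.Ioc 2 y, f σ τ k * c k =
        ∑ k ∈ (Finset.Ioc 2 y).filter Nat.Prime, Real.log k * f σ τ k := by
      rw [Finset.sum_filter]
      refine Finset.sum_congr rfl fun k _ => ?_
      simp only [hc]
      split_ifs <;> ring
    have h2 : ∑ p ∈ Nat.primesLE y, Real.log p * ((p : ℝ) ^ (-σ) * (1 - Real.cos (τ * Real.log p))) =
        ∑ k ∈ (Finset.Ioc 0 y).filter Nat.Prime, Real.log k * f σ τ k := by
      rw [Nat.primesLE_eq_filter_Ioc_zero]
      rfl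
    rw [h1, h2]
    refine Finset.sum_le_sum_of_subset_of_nonneg (Finset.filter_subset_filter _ (Finset.Ioc_subset_Ioc_left
      (by norm_num))) fun k _ _ => mul_nonneg (Real.log_natCast_nonneg k) (f_nonneg (Nat.cast_nonneg k) σ τ)
  -- decomposition of the integral `∫_2^Y f' ϑ = ∫_2^Y f' t · t + ∫_2^Y f'(ϑ - t)`
  have hmeasI : MeasurableSet (Set.Ioc (2 : ℝ) Y) := measurableSet_Ioc
  have hI1int : IntegrableOn (fun t : ℝ => f' σ τ t * t) (Set.Ioc 2 Y) :=
    ((hf'_cont.mul continuousOn_id).integrableOn_Icc).mono_set Set.Ioc_subset_Icc_self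
  have hbound2 : ∀ t ∈ Set.Ioc (2 : ℝ) Y, ‖f' σ τ t * (θ t - t)‖ ≤ (2 + |τ|) * (3 * Y) := by
    intro t ht
    have ht0 : 0 < t := by linarith [ht.1]
    have h1 := abs_f'_le ht0 hσ0 τ
    have hQ1 : t ^ (-σ - 1) ≤ 1 := Real.rpow_le_one_of_one_le_of_nonpos (by linarith [ht.1]) (by linarith)
    have h2 := abs_theta_sub_self_le ht0.le
    rw [Real.norm_eq_abs, abs_mul]
    have h3 : |f' σ τ t| ≤ 2 + |τ| := h1.trans (by nlinarith [abs_nonneg τ, Real.rpow_pos_of_pos ht0 (-σ - 1)])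
    have h4 : |θ t - t| ≤ 3 * Y := h2.trans (by linarith [ht.2])
    exact mul_le_mul h3 h4 (abs_nonneg _) (by positivity)
  have hI2meas : AEStronglyMeasurable (fun t : ℝ => f' σ τ t * (θ t - t)) (volume.restrict (Set.Ioc 2 Y)) :=
    ((hf'_cont.mono Set.Ioc_subset_Icc_self).aestronglyMeasurable hmeasI).mul
      ((measurable_theta.sub measurable_id).aestronglyMeasurable)
  have hI2int : IntegrableOn (fun t : ℝ => f' σ τ t * (θ t - t)) (Set.Ioc 2 Y) := by
    refine Integrable.mono' (g := fun _ => (2 + |τ|) * (3 * Y)) (integrableOn_const (by simp)) hI2meas ?_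
    rw [ae_restrict_iff' hmeasI]
    exact Eventually.of_forall hbound2
  have hI0 : ∫ t in Set.Ioc 2 Y, deriv (f σ τ) t * θ t =
      (∫ t in Set.Ioc 2 Y, f' σ τ t * t) + ∫ t in Set.Ioc 2 Y, f' σ τ t * (θ t - t) := by
    rw [← integral_add hI1int hI2int]
    refine setIntegral_congr_fun hmeasI fun t ht => ?_
    rw [hderiv t (by linarith [ht.1])]
    ring
  -- `∫_2^Y f' t · t = [t f(t)]_2^Y - (G(Y) - G(2))`
  have hI1 : ∫ t in Set.Ioc 2 Y, f' σ τ t * t = (Y * f σ τ Y - 2 * f σ τ 2) - (G σ τ Y - G σ τ 2) := by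
    rw [← intervalIntegral.integral_of_le hY2]
    have huIcc : Set.uIcc (2 : ℝ) Y = Set.Icc 2 Y := Set.uIcc_of_le hY2
    have hH : ∀ t ∈ Set.uIcc (2 : ℝ) Y, HasDerivAt (fun t : ℝ => t * f σ τ t) (f σ τ t + t * f' σ τ t) t := by
      intro t ht
      rw [huIcc] at ht
      exact ((hasDerivAt_id' t).mul (hasDerivAt_f (by linarith [ht.1]) σ τ)).congr_deriv (by ring)
    have hG : ∀ t ∈ Set.uIcc (2 : ℝ) Y, HasDerivAt (G σ τ) (f σ τ t) t := by
      intro t ht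
      rw [huIcc] at ht
      exact hasDerivAt_G (by linarith [ht.1]) hσ1 τ
    have hfi : IntervalIntegrable (f σ τ) volume 2 Y := (hf_cont.mono (by rw [huIcc])).intervalIntegrable
    have hf'i : IntervalIntegrable (fun t : ℝ => t * f' σ τ t) volume 2 Y :=
      ((continuousOn_id.mul hf'_cont).mono (by rw [huIcc])).intervalIntegrable
    have hsum_i : IntervalIntegrable (fun t : ℝ => f σ τ t + t * f' σ τ t) volume 2 Y := hfi.add hf'i
    have hFTC1 := intervalIntegral.integral_eq_sub_of_hasDerivAt hH hsum_i
    have hFTC2 := intervalIntegral.integral_eq_sub_of_hasDerivAt hG hfi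
    have hadd : ∫ t in (2 : ℝ)..Y, (f σ τ t + t * f' σ τ t) =
        (∫ t in (2 : ℝ)..Y, f σ τ t) + ∫ t in (2 : ℝ)..Y, t * f' σ τ t :=
      intervalIntegral.integral_add hfi hf'i
    have hcomm : ∫ t in (2 : ℝ)..Y, f' σ τ t * t = ∫ t in (2 : ℝ)..Y, t * f' σ τ t :=
      intervalIntegral.integral_congr fun t _ => mul_comm _ _
    rw [hcomm]
    linarith
  -- `|∫_2^Y f'(ϑ - t)| ≤ 3 C₂ (1 + |τ|) Y^β`
  have hI2 : |∫ t in Set.Ioc 2 Y, f' σ τ t * (θ t - t)| ≤ 3 * C₂ * (1 + |τ|) * Y ^ β := by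
    set K : ℝ := (2 * σ + |τ|) * C₂ * Y ^ β with hK
    have hK0 : 0 ≤ K := by positivity
    have hgint0 : IntegrableOn (fun t : ℝ => t⁻¹ / Real.log t ^ 2) (Set.Ioi 2) :=
      integrableOn_inv_div_log_pow (x := 2) one_lt_two 0
    have hgint : IntegrableOn (fun t : ℝ => K * (t⁻¹ / Real.log t ^ 2)) (Set.Ioc 2 Y) :=
      (hgint0.mono_set Set.Ioc_subset_Ioi_self).const_mul K
    have hptw : ∀ᵐ t ∂(volume.restrict (Set.Ioc 2 Y)), ‖f' σ τ t * (θ t - t)‖ ≤ K * (t⁻¹ / Real.log t ^ 2) := by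
      rw [ae_restrict_iff' hmeasI]
      refine Eventually.of_forall fun t ht => ?_
      have ht2 : 2 < t := ht.1
      have ht0 : 0 < t := by linarith
      have hlt : 0 < Real.log t := Real.log_pos (by linarith)
      have h1 := abs_f'_le ht0 hσ0 τ
      have h2 := hC₂ t ht2.le
      rw [Real.norm_eq_abs, abs_mul]
      have hQ : 0 < t ^ (-σ - 1) := Real.rpow_pos_of_pos ht0 _
      -- `t^{-σ-1} · t /log²t ≤ Y^β t⁻¹/log² t`
      have hpow : t ^ (-σ - 1) * t ≤ Y ^ β * t⁻¹ := by
        have e1 : t ^ (-σ - 1) * t = t ^ β * t⁻¹ := by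
          rw [hβdef, show -σ - 1 = (1 - σ) + (-1 + -1) by ring, Real.rpow_add ht0, Real.rpow_add ht0,
            Real.rpow_neg_one]
          field_simp
        rw [e1]
        exact mul_le_mul_of_nonneg_right (Real.rpow_le_rpow ht0.le ht.2 hβ0.le) (inv_nonneg.2 ht0.le)
      calc |f' σ τ t| * |θ t - t| ≤ (2 * σ + |τ|) * t ^ (-σ - 1) * (C₂ * t / Real.log t ^ 2) :=
            mul_le_mul h1 h2 (abs_nonneg _) (by positivity)
        _ = (2 * σ + |τ|) * C₂ * (t ^ (-σ - 1) * t) / Real.log t ^ 2 := by ring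
        _ ≤ (2 * σ + |τ|) * C₂ * (Y ^ β * t⁻¹) / Real.log t ^ 2 := by gcongr
        _ = K * (t⁻¹ / Real.log t ^ 2) := by rw [hK]; ring
    have hle := norm_integral_le_of_norm_le hgint hptw
    rw [Real.norm_eq_abs] at hle
    refine hle.trans ?_
    have hmono : ∫ t in Set.Ioc 2 Y, K * (t⁻¹ / Real.log t ^ 2) ≤ ∫ t in Set.Ioi 2, K * (t⁻¹ / Real.log t ^ 2) := by
      refine setIntegral_mono_set (hgint0.const_mul K) ?_ Set.Ioc_subset_Ioi_self.eventuallyLE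
      rw [EventuallyLE, ae_restrict_iff' measurableSet_Ioi]
      refine Eventually.of_forall fun t (ht : 2 < t) => ?_
      have : 0 < Real.log t := Real.log_pos (by linarith)
      have : 0 < t := by linarith
      positivity
    refine hmono.trans ?_
    rw [integral_const_mul]
    have hval : ∫ t in Set.Ioi (2 : ℝ), t⁻¹ / Real.log t ^ 2 = (Real.log 2)⁻¹ := by
      have h := integral_Ioi_inv_div_log_pow (x := 2) one_lt_two 0
      rw [show (fun t : ℝ => t⁻¹ / Real.log t ^ 2) = fun t : ℝ => t⁻¹ / Real.log t ^ (0 + 2) from rfl, h]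
      norm_num
    rw [hval]
    -- `K/log 2 ≤ 3 C₂ (1+|τ|) Y^β`
    have hinv : (Real.log 2)⁻¹ ≤ 3 / 2 := by
      rw [inv_le_comm₀ (by linarith) (by norm_num)]; linarith
    have hσ1' : σ ≤ 1 := by linarith
    calc K * (Real.log 2)⁻¹ ≤ K * (3 / 2) := mul_le_mul_of_nonneg_left hinv hK0
      _ = (2 * σ + |τ|) * (3 / 2) * C₂ * Y ^ β := by rw [hK]; ring
      _ ≤ (2 * (1 + |τ|)) * (3 / 2) * C₂ * Y ^ β := by gcongr; nlinarith [abs_nonneg τ]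
      _ = 3 * C₂ * (1 + |τ|) * Y ^ β := by ring
  -- boundary terms `f(Y)(ϑ(Y) - Y)` and `f(2)(ϑ(2) - 2)`
  have hbY : |f σ τ Y * (θ Y - Y)| ≤ 9 / 2 * C₂ * Y ^ β := by
    have h1 := hC₂ Y hY2
    have hfY := f_le hY0.le σ τ
    have hf0 := f_nonneg hY0.le σ τ
    have hlY : Real.log 2 ≤ Real.log Y := Real.log_le_log (by norm_num) hY2
    have hlY0 : 0 < Real.log Y := by linarith
    rw [abs_mul, abs_of_nonneg hf0]
    have e1 : Y ^ (-σ) * Y = Y ^ β := by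
      rw [hβdef, show (1 - σ) = -σ + 1 by ring, Real.rpow_add hY0, Real.rpow_one]
    have h2 : C₂ * Y / Real.log Y ^ 2 ≤ C₂ * Y * (9 / 4) := by
      rw [div_le_iff₀ (by positivity)]
      have h23 : (2 : ℝ) / 3 ≤ Real.log Y := by linarith
      have h94 : (1 : ℝ) ≤ 9 / 4 * Real.log Y ^ 2 := by
        have := mul_le_mul h23 h23 (by norm_num) (by linarith)
        nlinarith
      have := mul_le_mul_of_nonneg_left h94 (mul_nonneg hC₂0 hY0.le)
      linarith
    calc f σ τ Y * |θ Y - Y| ≤ 2 * Y ^ (-σ) * (C₂ * Y * (9 / 4)) :=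
          mul_le_mul hfY (h1.trans h2) (abs_nonneg _) (by positivity)
      _ = 9 / 2 * C₂ * (Y ^ (-σ) * Y) := by ring
      _ = 9 / 2 * C₂ * Y ^ β := by rw [e1]
  have hb2 : |f σ τ 2 * (θ 2 - 2)| ≤ 9 * C₂ := by
    have h1 := hC₂ 2 le_rfl
    have hf2 := f_le (by norm_num : (0 : ℝ) ≤ 2) σ τ
    have hf0 := f_nonneg (by norm_num : (0 : ℝ) ≤ 2) σ τ
    have hp : (2 : ℝ) ^ (-σ) ≤ 1 := Real.rpow_le_one_of_one_le_of_nonpos (by norm_num) (by linarith)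
    rw [abs_mul, abs_of_nonneg hf0]
    have h2 : C₂ * 2 / Real.log 2 ^ 2 ≤ C₂ * 2 * (9 / 4) := by
      rw [div_le_iff₀ (by positivity)]
      have h94 : (1 : ℝ) ≤ 9 / 4 * Real.log 2 ^ 2 := by
        have := mul_le_mul hlog2.le hlog2.le (by norm_num) (by linarith)
        nlinarith
      have := mul_le_mul_of_nonneg_left h94 (mul_nonneg hC₂0 (by norm_num : (0 : ℝ) ≤ 2))
      linarith
    calc f σ τ 2 * |θ 2 - 2| ≤ 2 * (2 : ℝ) ^ (-σ) * (C₂ * 2 * (9 / 4)) :=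
          mul_le_mul hf2 (h1.trans h2) (abs_nonneg _) (by positivity)
      _ ≤ 2 * 1 * (C₂ * 2 * (9 / 4)) := by gcongr
      _ = 9 * C₂ := by ring
  -- assemble
  have hmain := G_sub_G_ge hY2 hσ0 hσ1 τ
  rw [← hβdef] at hmain
  have hI2' := (abs_le.1 hI2).2
  have hbY' := (abs_le.1 hbY).1
  have hb2' := (abs_le.1 hb2).2
  have hkey : ∑ k ∈ Finset.Ioc 2 y, f σ τ k * c k =
      (G σ τ Y - G σ τ 2) + f σ τ Y * (θ Y - Y) - f σ τ 2 * (θ 2 - 2) -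
        ∫ t in Set.Ioc 2 Y, f' σ τ t * (θ t - t) := by
    rw [habel, hI0, hI1]; ring
  have herr : 9 / 2 * C₂ * Y ^ β + 9 * C₂ + 3 * C₂ * (1 + |τ|) * Y ^ β ≤ 17 * C₂ * (1 + |τ|) * Y ^ β := by
    have hτ1 : (1 : ℝ) ≤ 1 + |τ| := by linarith [abs_nonneg τ]
    have hP : (1 : ℝ) ≤ (1 + |τ|) * Y ^ β := one_le_mul_of_one_le_of_one_le hτ1 hYβ1
    have h1 : 9 * C₂ ≤ 9 * C₂ * ((1 + |τ|) * Y ^ β) := by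
      have := mul_le_mul_of_nonneg_left hP (show 0 ≤ 9 * C₂ by positivity); linarith
    have h2 : 9 / 2 * C₂ * Y ^ β ≤ 9 / 2 * C₂ * ((1 + |τ|) * Y ^ β) := by
      have hYb : Y ^ β ≤ (1 + |τ|) * Y ^ β := le_mul_of_one_le_left (by positivity) hτ1
      exact mul_le_mul_of_nonneg_left hYb (by positivity)
    have h3 : 0 ≤ C₂ * ((1 + |τ|) * Y ^ β) := by positivity
    have e1 : 3 * C₂ * (1 + |τ|) * Y ^ β = 3 * (C₂ * ((1 + |τ|) * Y ^ β)) := by ring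
    have e2 : 17 * C₂ * (1 + |τ|) * Y ^ β = 17 * (C₂ * ((1 + |τ|) * Y ^ β)) := by ring
    have e3 : 9 * C₂ * ((1 + |τ|) * Y ^ β) = 9 * (C₂ * ((1 + |τ|) * Y ^ β)) := by ring
    have e4 : 9 / 2 * C₂ * ((1 + |τ|) * Y ^ β) = 9 / 2 * (C₂ * ((1 + |τ|) * Y ^ β)) := by ring
    rw [e1, e2]
    rw [e3] at h1
    rw [e4] at h2
    linarith
  linarith [hlhs, hkey, hmain, hI2', hbY', hb2', herr]

/-- **Corollary (the decay sum).** With the same `C`: for `y ≥ 2`, `0 ≤ σ < 1`, `β = 1 - σ` and real `τ`,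
`Σ_{p ≤ y} p^{-σ}(1 - cos(τ log p)) ≥ (y^β τ²/(2β(β² + τ²)) - C(1 + |τ|) y^β - 4/β)/log y`
(`log p ≤ log y`). In Hildebrand–Tenenbaum's notation this is `W ≫ ū τ²/((1-α)² + τ²)` once
`y^{1-α}/((1-α) log y) ≍ ū` is inserted. [cite: HildebrandTenenbaum1986, Lemma 8 (ii), (3.16)] -/
theorem exists_decaySum_ge_pnt :
    ∃ C : ℝ, 0 ≤ C ∧ ∀ (y : ℕ), 2 ≤ y → ∀ (σ τ : ℝ), 0 ≤ σ → σ < 1 →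
      ((y : ℝ) ^ (1 - σ) * τ ^ 2 / (2 * (1 - σ) * ((1 - σ) ^ 2 + τ ^ 2)) -
          C * (1 + |τ|) * (y : ℝ) ^ (1 - σ) - 4 / (1 - σ)) / Real.log y ≤
        ∑ p ∈ Nat.primesLE y, (p : ℝ) ^ (-σ) * (1 - Real.cos (τ * Real.log p)) := by
  obtain ⟨C, hC0, hC⟩ := exists_sum_log_mul_decay_ge
  refine ⟨C, hC0, fun y hy σ τ hσ0 hσ1 => ?_⟩
  have hy1 : (1 : ℝ) < y := by exact_mod_cast (lt_of_lt_of_le one_lt_two hy)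
  have hlogy : 0 < Real.log y := Real.log_pos hy1
  rw [div_le_iff₀ hlogy, Finset.sum_mul]
  refine (hC y hy σ τ hσ0 hσ1).trans (Finset.sum_le_sum fun p hp => ?_)
  have hp := (Nat.mem_primesLE.1 hp)
  have hp0 : (0 : ℝ) < p := by exact_mod_cast hp.2.pos
  have hlogp : Real.log p ≤ Real.log y := Real.log_le_log hp0 (by exact_mod_cast hp.1)
  have hterm : 0 ≤ (p : ℝ) ^ (-σ) * (1 - Real.cos (τ * Real.log p)) := f_nonneg hp0.le σ τ
  rw [mul_comm]
  exact mul_le_mul_of_nonneg_left hlogp hterm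

end DecayPNT

end Literature.NumberTheory.Sieve

end
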